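import Summits.Ventures.HodgeRepro2.T5LandherrGeneral
import Summits.Ventures.HodgeRepro2.T5LandherrInvariantsIff

/-!
# The general-rank statements of files 156 / 161 / 163 on the two O'Meara displays (cell pub-hodge-repro2, seat p3)

Tier-5 N2 support, rows N2.2.7 / N2.2.9 / N2.8.1 of route/T5-N2-route-3.md. File 173 proves file 156's display
`GrossBH2021_Thm3_1_uniqueness K n` for every finite `n` from `OMeara1963_66_1 K⁺` and `OMeara1963_63_19 K⁺`; here
the general-rank consumers of that display are restated on the two O'Meara displays (file 169 did the rank-2 case):
* `isCongruent_of_det_eq_mul_norm_OMeara'` / `isCongruent_of_det_eq_OMeara'`: Shimura's Theorem 2.2 (i) in Gram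
  form in every rank (file 161);
* `isCongruent_iff_invariants_OMeara'`: the same as an `iff` (file 163);
* `isCongruent_of_chain_OMeara'` / `isCongruent_of_chain_K7_OMeara'`: file 156's general chain (the selection rule,
  `|D| ≤ 1`, Hilbert reciprocity 71:18 — t6-p4's display) in every rank, with Landherr's display replaced.
No new display; no device. §8(d): uses an L-value-free non-vanishing device: NO.
-/

namespace Summit.Ventures.HodgeRepro2.T5LandherrOfHasseMinkowskiGeneral

open Matrix NumberField NumberField.IsCMField IsDedekindDomain IsDedekindDomain.HeightOneSpectrum
open Summit.Ventures.HodgeRepro2.T5HasseMinkowskiDisplays Summit.Ventures.HodgeRepro2.T5HermitianDetClass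
  Summit.Ventures.HodgeRepro2.T5HermitianGlobalChain Summit.Ventures.HodgeRepro2.T5LandherrInvariants
  Summit.Ventures.HodgeRepro2.T5LandherrInvariantsIff Summit.Ventures.HodgeRepro2.T5LandherrGeneral

variable {K : Type*} [Field K] [NumberField K] [IsCMField K]

/-- Theorem 2.2 (i) in Gram form, every rank, from the two O'Meara displays (file 161's
`isCongruent_of_det_eq_mul_norm`). -/
theorem isCongruent_of_det_eq_mul_norm_OMeara' (hHM : OMeara1963_66_1 (maximalRealSubfield K))
    (h5 : OMeara1963_63_19 (maximalRealSubfield K)) {n : Type*} [Fintype n] [DecidableEq n]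
    {H H' : Matrix n n K} (hH : H.IsHermitian) (hH' : H'.IsHermitian) (hdet : IsUnit H.det)
    (hdet' : IsUnit H'.det) (z : K) (hz : H'.det = z * star z * H.det)
    (hreal : ∀ φ : K →+* ℂ, IsCongruent (H.map φ) (H'.map φ)) : IsCongruent H H' :=
  isCongruent_of_det_eq_mul_norm hH hH' hdet hdet' z hz hreal (grossBH2021_of_OMeara hHM h5 n)

/-- The equal-determinant case, every rank (file 161's `isCongruent_of_det_eq`). -/
theorem isCongruent_of_det_eq_OMeara' (hHM : OMeara1963_66_1 (maximalRealSubfield K))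
    (h5 : OMeara1963_63_19 (maximalRealSubfield K)) {n : Type*} [Fintype n] [DecidableEq n]
    {H H' : Matrix n n K} (hH : H.IsHermitian) (hH' : H'.IsHermitian) (hdet : IsUnit H.det)
    (hdet' : IsUnit H'.det) (hdeq : H'.det = H.det)
    (hreal : ∀ φ : K →+* ℂ, IsCongruent (H.map φ) (H'.map φ)) : IsCongruent H H' :=
  isCongruent_of_det_eq hH hH' hdet hdet' hdeq hreal (grossBH2021_of_OMeara hHM h5 n)

/-- Theorem 2.2 (i) as an `iff` in Gram form, every rank, from the two O'Meara displays (file 163's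
`isCongruent_iff_invariants`). -/
theorem isCongruent_iff_invariants_OMeara' (hHM : OMeara1963_66_1 (maximalRealSubfield K))
    (h5 : OMeara1963_63_19 (maximalRealSubfield K)) {n : Type*} [Fintype n] [DecidableEq n]
    {H H' : Matrix n n K} (hH : H.IsHermitian) (hH' : H'.IsHermitian) (hdet : IsUnit H.det)
    (hdet' : IsUnit H'.det) :
    IsCongruent H H' ↔
      ((∃ z : K, z ≠ 0 ∧ H'.det = z * star z * H.det) ∧
        ∀ φ : K →+* ℂ, IsCongruent (H.map φ) (H'.map φ)) :=
  isCongruent_iff_invariants hH hH' hdet hdet' (grossBH2021_of_OMeara hHM h5 n)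

/-- File 156's general chain (`isCongruent_of_chain`) in every rank, with Landherr's display replaced by the two
O'Meara displays. -/
theorem isCongruent_of_chain_OMeara' (hHM : OMeara1963_66_1 (maximalRealSubfield K))
    (h5 : OMeara1963_63_19 (maximalRealSubfield K)) {θ : maximalRealSubfield K} {y : K}
    (hθ : algebraMap (maximalRealSubfield K) K θ = y ^ 2) (hy : complexConj K y ≠ y)
    {n : Type*} [Fintype n] [DecidableEq n] {H H' : Matrix n n K}
    (hH : H.IsHermitian) (hH' : H'.IsHermitian) (hdet : IsUnit H.det) (hdet' : IsUnit H'.det)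
    (hodd : ∀ v : HeightOneSpectrum (𝓞 (maximalRealSubfield K)),
      ¬ IsSquare (algebraMap (maximalRealSubfield K) (v.adicCompletion (maximalRealSubfield K)) θ) →
      IsUnit (2 : adicCompletionIntegers (maximalRealSubfield K) v) → LocallyCongruent K v H H')
    (hreal : ∀ φ : K →+* ℂ, IsCongruent (H.map φ) (H'.map φ))
    (hD : (dyadicNonSplit K (θ := θ)).Subsingleton)
    (hrec : Summit.Ventures.HodgeRepro2.T6.Hyp.OMeara1963_71_18 (maximalRealSubfield K)) :
    IsCongruent H H' :=
  isCongruent_of_chain hθ hy hH hH' hdet hdet' hodd hreal hD hrec (grossBH2021_of_OMeara hHM h5 n)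

open Summit.Ventures.HodgeRepro2.CyclotomicSeven in
/-- File 156's chain on the field of record `ℚ(ζ₇)` (`isCongruent_of_chain_K7`) in every rank, on the two O'Meara
displays. -/
theorem isCongruent_of_chain_K7_OMeara' (hHM : OMeara1963_66_1 (maximalRealSubfield K7))
    (h5 : OMeara1963_63_19 (maximalRealSubfield K7)) {n : Type*} [Fintype n] [DecidableEq n]
    {H H' : Matrix n n K7}
    (hH : H.IsHermitian) (hH' : H'.IsHermitian) (hdet : IsUnit H.det) (hdet' : IsUnit H'.det)
    (hodd : ∀ v : HeightOneSpectrum (𝓞 (maximalRealSubfield K7)),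
      ¬ IsSquare (algebraMap (maximalRealSubfield K7) (v.adicCompletion (maximalRealSubfield K7)) (-7)) →
      IsUnit (2 : adicCompletionIntegers (maximalRealSubfield K7) v) → LocallyCongruent K7 v H H')
    (hreal : ∀ φ : K7 →+* ℂ, IsCongruent (H.map φ) (H'.map φ)) : IsCongruent H H' :=
  isCongruent_of_chain_K7 hH hH' hdet hdet' hodd hreal (grossBH2021_of_OMeara hHM h5 n)

end Summit.Ventures.HodgeRepro2.T5LandherrOfHasseMinkowskiGeneral
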